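import Literature.MathematicalPhysics.QuantumFieldTheory.Balaban1983to89.Node00.RStepProvisosOfRecord
import Literature.MathematicalPhysics.QuantumFieldTheory.Balaban1983to89.Node00.TStepOfRecordAE

/-!
# NODE 00 — DEFINER ₇ (R-side), FILE 12: the (0.3) ∕ (0.4) chain of the ℝ-operation under ESSENTIAL (a.e.) provisos —
# the measurable-modification device for `lmarginal`, the third proviso form `ProvisoForm.ess`, and its faces at the
# tower of record (the R-half of repair (R-a))

T. Bałaban, *Large field renormalization. I*, Commun. Math. Phys. **122** (1989) 175–202 [Balaban1989LargeFieldI] = [IV], (0.2)–(0.4)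
p. 176 and (1.102) p. 201; *Convergent renormalization expansions …*, Commun. Math. Phys. **119** (1988) 243–285 [Balaban1988Convergent]
= [III], (2.17)–(2.18) p. 257.  Cell `pub-ymgap`, seat `pub-ymgap-node00-def-R` g3, REACTIVATE №5 (t-R3); the T-half of (R-a) is dag-n23-b's
`Node00/TStepOfRecordAE` (p430089).  FILE 6 = `Node00/ROperationOfRecordAE` (token `AE` = the a.e. IDENTITY `total =ᵐ ρ` of admissibility),
FILE 9′ = `Node00/ROperationOfRecordForm` (proviso FORMS), FILE 10 = `Node00/RStepProvisosOfRecord`; b01 = `B15BasicStep`, n10-b =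
`B15FibreLemmaSupp`.  Token `Ess` (this file) = the ESSENTIAL form of the (0.3) provisos: every clause an a.e. ∕ a.e.-measurability clause.

CITATION HEADER (verbatim, [IV] p. 176): (0.3) *«(ℝρ)(V) = Σ_Z ρ(Z″, V) ∫dV⌈_{Z′}ρ(Z, V) ∕ ∫dV⌈_{Z′}ρ(Z″, V)»*; *«the densities are positive,
and the integration domains in the integrals above are nonempty, hence the denominators are positive»*; (0.4) *«It satisfies the basic
normalization property ∫dV(𝐑ρ)(V) = ∫dVρ(V).»*

WHY.  b01's PROVED (0.4) chain (`integral_normTerm_eq → integral_ropReal_eq`) and n10-b's support form of it run on Mathlib's `lmarginal`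
(`∫⋯∫⁻_s, f ∂μ`, the fibre integral `∫dV⌈_{Z′}`), which is only well-behaved for genuinely `Measurable` integrands (Mathlib, `Marginal.lean`:
the marginal of a merely a.e.-measurable function is not even well-posed pointwise).  Hence `RepData.Provisos` ∕ `ProvisosSupp` ask every
piece `ρ(Z, ·)` to be `Measurable`, bounded EVERYWHERE, with the support clause at EVERY base point — and at the objects of record these are
statements about a chosen representative (the slots of record read an `rnDeriv` version; the χ's of record read a `Classical.choose`
solution map: dag-n23-b's census `K0-TYPING-CENSUS.md` v1.2 §2–§3), which a record about DETERMINED objects cannot state (plan's bar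
(I3-version-T) for `Record11`: «no conjunct of `Provisos` quantifies over an unpinned representative»).  THIS FILE supplies the device that
lets the chain accept the ESSENTIAL form — pieces a.e.-strongly measurable, `0 ≤ ρ(Z,·) ≤ C` almost everywhere, the support clause almost
everywhere — with the SAME conclusions for the ORIGINAL pieces, and plugs it into FILE 9′'s form-generic architecture as a third
`ProvisoForm`:

* §1 THE DEVICE (generic): **`lmarginal_congr_ae`** — `f =ᵐ[Measure.pi μ] g → ∫⋯∫⁻_s, f ∂μ =ᵐ[Measure.pi μ] ∫⋯∫⁻_s, g ∂μ` for ANY `f, g`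
  (no measurability): a `Measure.pi μ`-null set has `Measure.pi`-almost-every fibre section null (Fubini for null sets through the measurable
  equivalence `piEquivPiSubtypeProd`, `ae_ae_eq_comp_symm_of_measurePreserving`).  Over `Setup`: `fibreIntegral_congr_ae`, `normTerm_congr_ae`,
  **`ropReal_congr_ae`** («(0.3) a.e. in V»: a.e.-equal piece families have a.e.-equal (0.3) densities),
  `aestronglyMeasurable_fibreIntegral`, `aestronglyMeasurable_normTerm` (measurability of `∫dV⌈_{Z′}ρ` itself is a PRIVATE in-cone
  copy of the landed `B15Norm1102Object.measurable_fibreIntegral` ∕ `T4ObservableTelescope.measurable_fibreIntegral`, dag-n23-b's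
  precedent in `Record9ProvisosOfRegularity` — importing either home would put `B15Sect1Statements` ∕ the `T4` observable series into
  every record's cone; this file adds NO import to the R-side cone beyond n23-b's `TStepOfRecordAE`).
* §2 THE SUPPORT MODIFICATION (layer β: measurable pieces, A.E. support clause): `suppMod s new old := (V ↦ if ∫dV⌈_s new V = 0 then 0 else old V)`
  is measurable, satisfies n10-b's POINTWISE support clause, equals `old` almost everywhere under the a.e. clause, and — the point —
  `normTerm s new (suppMod s new old) = normTerm s new old` EVERYWHERE (where the denominator vanishes both sides read `new·(_ ∕ 0) = 0`;
  elsewhere the fibre integral of `new` is fibre-constant (n10-b `fibreIntegral_updateFinset`), so the whole fibre carries the same `old`).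
  Hence **`integral_normTerm_eq_suppAE`** = n10-b's `integral_normTerm_eq_supp` with `∀ V` weakened to `∀ᵐ V`, and **`integrable_normTerm_bdd`**:
  integrability of the normalised term needs NO support clause at all (only the (0.4) IDENTITY does).
* §3 THE ESSENTIAL FORM (layer γ: everything a.e.): clip a strongly measurable version, `max 0 (min C (hf.mk f))` (`exists_measurable_modification`),
  move the a.e. support clause across a.e.-equal pieces (`suppClause_congr_ae`, by §1), run §2 on the modifications and come back along
  `normTerm_congr_ae`: **`integral_ropReal_eq_ess`**, **`integrable_ropReal_ess`** (no support clause), `ropReal_nonneg_ae` — (0.4) and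
  integrability of the ORIGINAL (0.3) density.
* §4 THE DATUM: **`RepData.ProvisosEss`** (n10-b's four conjuncts in essential form — census §3 (R-a) verbatim), `provisosEss_of_provisosSupp`,
  `provisosEss_of_provisos`, **`integral_rop_eq_of_provisosEss`** ((0.4) FOR THE DATUM), **`integrable_rop_of_provisosEss`**,
  `rop_nonneg_ae_of_provisosEss`, `integrable_total_of_provisosEss`.
* §5 THE FORM AND THE PINS (TS-8 instance-closed, as FILE 9′): **`ProvisoForm.ess`** (third form beside `.std` ∕ `.supp`), monotonicity
  `ess_of_supp` ∕ `ess_of_std` ∕ `admissibleBy_ess_of_supp`, `…_instIrrel`, `ropTotalBy_ess_nonneg_ae`; `ProvisoFormOfRecord.ess`,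
  **`ROp03EssOfRecord`** (v1.3 = `R` of record over the essential form — OFFERED, not swapped: the ₇ plug of record stays v1.2
  `ROp03SuppOfRecord` unless a successor record adopts v1.3; v1.3 is admissible wherever v1.2 is) with the `Residual₅`-shaped
  `preservesIntegral_ROp03EssOfRecord` ∕ `integrable_ROp03EssOfRecord` and the branch lemmas.
* §6 GENERIC (2.18) FACES (FILE 10 §1 twins): `provisosEss_repDataOfSel_iff` (`Iff.rfl`), `provisosEss_repDataOfSel_of_factors_ae`.
* §7 TOWER-OF-RECORD FACES (FILE 10 §2 ∕ FILE 9′ §5 twins, consumer's instance): **`provisosEss_towerRepOfRecord_iff`** (`Iff.rfl`; conjunct 3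
  IS dag-n23-b's `EssBddPiecesOfRecord`), `…_of_provisosSupp`, **`provisosEss_towerRepOfRecord_of_slots_ae`** (sufficient DISPLAYED a.e. slot
  conditions), `…_of_slot_eq_zero` (K0 junk inhabitant), **`integral_densityOfSlice_rstepSlotOfRecord_of_provisosEss`** ((0.4) at a slot
  family), **`integrable_densityOfSlice_rstepSlotOfRecord_of_provisosEss`**, the `_of_slots_ae` composites, and the plug-at-the-tower faces
  `ROp03EssOfRecord_repOfDataAE_of_ae` ∕ `_repOfRecordAE_of_ae` ∕ `_repOfRecordAE_eq_densityOfSlice` ∕ `integral_ROp03EssOfRecord_repOfRecordAE`.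

## HONEST FRAMING — what this is NOT

* Kernel lemmas under WEAKER hypotheses and displayed `def`s; nothing of Bałaban's asserted (no proviso, no (1.1)–(1.80) estimate, no shape
  law (2.19)–(2.44)); no node count moves.  Whether the χ's ∕ slots OF RECORD satisfy the essential clauses is a statement about the objects
  of record that a record DISPLAYS where it uses them — this file does not decide it.  (R-b) ∕ (R-c) of the census are not this file.
* The vacuity rider (R-C2) and the FORMAT FACE rider concern the `Sect2Form` faces of a record, not this form module; the one vacuity-direction
  fact typed here is the zero-slot junk inhabitant `provisosEss_towerRepOfRecord_of_slot_eq_zero` (via FILE 10's).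
* One finite four-torus programme at fixed `ε` — NOT the continuum limit on ℝ⁴, NOT infinite volume, NOT OS, NOT a mass gap, NOT the Clay
  problem.  No `sorry` ∕ `axiom` ∕ `opaque` ∕ `instance` ∕ `notation`.
-/

open scoped BigOperators ENNReal
open _root_.MeasureTheory Function

noncomputable section

/-! ## §1  THE DEVICE: `lmarginal` respects a.e. equality for the product measure; fibre integrals and (0.3) of a.e.-equal pieces -/

namespace Literature.MathematicalPhysics.QuantumFieldTheory.Balaban1983to89.B15.BasicStep

section Device

/-- **Fubini for null sets through a measure-preserving equivalence onto a product**: if `e : Z ≃ᵐ Y × W` pushes `ρ` to `νY ⊗ νW` and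
`f = g` `ρ`-a.e., then for `ρ`-a.e. `x` the two functions `y ↦ f (e⁻¹ (y, (e x).2))`, `y ↦ g (e⁻¹ (y, (e x).2))` (vary the `Y`-coordinate,
keep `x`'s `W`-coordinate) agree `νY`-a.e.  No measurability of `f`, `g` is needed (a `νY ⊗ νW`-null set has `νY`-null sections for
`νW`-a.e. second coordinate, `Measure.ae_ae_of_ae_prod`).  Folklore measure theory; the cited display is where it serves (the a.e. reading of the
fibre integrals `∫dV⌈_{Z′}` of (0.3)). [cite: Balaban1989LargeFieldI, (0.3)–(0.4) p.176 (measure-theoretic bookkeeping: Fubini for null sets)] -/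
theorem ae_ae_eq_comp_symm_of_measurePreserving {Z Y W : Type*} [MeasurableSpace Z] [MeasurableSpace Y] [MeasurableSpace W]
    {ρ : Measure Z} {νY : Measure Y} {νW : Measure W} [SFinite νY] [SFinite νW] (e : Z ≃ᵐ Y × W)
    (he : MeasurePreserving e ρ (νY.prod νW)) {β : Type*} {f g : Z → β} (h : f =ᵐ[ρ] g) :
    ∀ᵐ x ∂ρ, (fun y => f (e.symm (y, (e x).2))) =ᵐ[νY] fun y => g (e.symm (y, (e x).2)) := by
  have h1 : ∀ᵐ q ∂(νY.prod νW), f (e.symm q) = g (e.symm q) := (he.symm e).quasiMeasurePreserving.ae h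
  have h2 : ∀ᵐ q ∂(νW.prod νY), f (e.symm q.swap) = g (e.symm q.swap) :=
    (Measure.measurePreserving_swap (μ := νW) (ν := νY)).quasiMeasurePreserving.ae h1
  have h3 : ∀ᵐ w ∂νW, ∀ᵐ y ∂νY, f (e.symm (y, w)) = g (e.symm (y, w)) := Measure.ae_ae_of_ae_prod h2
  exact (Measure.quasiMeasurePreserving_snd.comp he.quasiMeasurePreserving).ae h3

/-- **`lmarginal` RESPECTS A.E. EQUALITY FOR THE PRODUCT MEASURE** (the lemma Mathlib's `Marginal.lean` does not carry): if `f = g`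
`Measure.pi μ`-a.e. then `∫⋯∫⁻_s, f ∂μ = ∫⋯∫⁻_s, g ∂μ` `Measure.pi μ`-a.e., for ANY `f g : (Π i, X i) → ℝ≥0∞` and any `Finset` `s` of
coordinates (σ-finite factors).  Proof: split `Π i, X i ≃ᵐ (Π i∈s, X i) × (Π i∉s, X i)` (`measurePreserving_piEquivPiSubtypeProd`); the fibre
of `lmarginal` through `x` is `y ↦ e⁻¹ (y, x⌈_{sᶜ})` (`updateFinset`, `rfl`); apply `ae_ae_eq_comp_symm_of_measurePreserving`.  Folklore measure
theory; the cited display is where it serves (the fibre integrals `∫dV⌈_{Z′}` of (0.3) read on a.e.-classes of densities).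
[cite: Balaban1989LargeFieldI, (0.3)–(0.4) p.176 (measure-theoretic bookkeeping: `∫dV⌈_{Z′}` respects `dV`-a.e. equality)] -/
theorem lmarginal_congr_ae {δ : Type*} [DecidableEq δ] [Fintype δ] {X : δ → Type*} [∀ i, MeasurableSpace (X i)]
    (μ : ∀ i, Measure (X i)) [∀ i, SigmaFinite (μ i)] (s : Finset δ) {f g : (∀ i, X i) → ℝ≥0∞}
    (h : f =ᵐ[Measure.pi μ] g) : ∫⋯∫⁻_s, f ∂μ =ᵐ[Measure.pi μ] ∫⋯∫⁻_s, g ∂μ := by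
  have he := measurePreserving_piEquivPiSubtypeProd μ (fun i => i ∈ s)
  -- `lmarginal` reads the `Fintype ↥s` instance `Finset.Subtype.fintype`; align the measure-preserving statement with it
  rw [(Subsingleton.elim _ _ : Subtype.fintype (fun i => i ∈ s) = Finset.Subtype.fintype s)] at he
  refine (ae_ae_eq_comp_symm_of_measurePreserving _ he h).mono fun x hx => ?_
  have hupd : ∀ y : ∀ i : s, X i, updateFinset x s y =
      (MeasurableEquiv.piEquivPiSubtypeProd X (fun i => i ∈ s)).symm
        (y, ((MeasurableEquiv.piEquivPiSubtypeProd X (fun i => i ∈ s)) x).2) := fun _ => rfl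
  show ∫⁻ y, f (updateFinset x s y) ∂_ = ∫⁻ y, g (updateFinset x s y) ∂_
  simp only [hupd]
  exact lintegral_congr_ae hx

end Device

/-! ### Over `Setup`: fibre integrals, normalised terms and (0.3) of a.e.-equal densities -/

section SetupAE

variable {P : Params} {j : ℕ} {G : Type*} [GaugeGroup G] [MeasurableSpace G] [HaarData G]
variable [DecidableEq (PBond P j)]

/-- `∫dV⌈_{Z′} f` is a measurable function of the field for measurable `f`.  PRIVATE in-cone copy (verbatim statement and proof) of
the landed `B15Norm1102Object.measurable_fibreIntegral` ∕ `T4ObservableTelescope.measurable_fibreIntegral`, kept private to leave the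
NODE 00 cone free of `B15Sect1Statements` ∕ the `T4` observable series (dag-n23-b's precedent, dag-lead DEDUP-67). [folklore] -/
private theorem measurable_fibreIntegral (s : Finset (PBond P j)) {f : Density P j G} (hf : Measurable f) :
    Measurable (fibreIntegral s f) :=
  ((ofReal_comp_measurable hf).lmarginal (fun _ : PBond P j => (HaarData.haar : Measure G))).ennreal_toReal

/-- **A.e.-equal densities have a.e.-equal restricted fibre integrals `∫dV⌈_{Z′}`** (`lmarginal_congr_ae` over `Setup.fieldMeasure`, the
product of the normalised Haar measures). [cite: Balaban1989LargeFieldI, (0.3) p.176 (bookkeeping)] -/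
theorem fibreIntegral_congr_ae (s : Finset (PBond P j)) {f g : Density P j G} (h : f =ᵐ[fieldMeasure P j G] g) :
    fibreIntegral s f =ᵐ[fieldMeasure P j G] fibreIntegral s g := by
  have h' : (fun U => ENNReal.ofReal (f U)) =ᵐ[Measure.pi fun _ : PBond P j => (HaarData.haar : Measure G)]
      fun U => ENNReal.ofReal (g U) := by
    rw [← fieldMeasure_eq_pi]
    exact h.mono fun U hU => congrArg ENNReal.ofReal hU
  have hm := lmarginal_congr_ae (fun _ : PBond P j => (HaarData.haar : Measure G)) s h'
  rw [← fieldMeasure_eq_pi] at hm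
  exact hm.mono fun V hV => by simp only [fibreIntegral]; rw [hV]

/-- The fibre integral of an a.e.-strongly measurable density is a.e.-strongly measurable (it agrees a.e. with the fibre integral of a
measurable version). [cite: Balaban1989LargeFieldI, (0.3) p.176 (bookkeeping)] -/
theorem aestronglyMeasurable_fibreIntegral (s : Finset (PBond P j)) {f : Density P j G}
    (hf : AEStronglyMeasurable f (fieldMeasure P j G)) : AEStronglyMeasurable (fibreIntegral s f) (fieldMeasure P j G) :=
  (measurable_fibreIntegral s hf.stronglyMeasurable_mk.measurable).aestronglyMeasurable.congr
    (fibreIntegral_congr_ae s hf.ae_eq_mk).symm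

/-- **A.e.-equal pieces have a.e.-equal normalised (0.3)-terms** `new·∫dV⌈old ∕ ∫dV⌈new`. [cite: Balaban1989LargeFieldI, (0.3) p.176 (bookkeeping)] -/
theorem normTerm_congr_ae (s : Finset (PBond P j)) {new new' old old' : Density P j G}
    (hn : new =ᵐ[fieldMeasure P j G] new') (ho : old =ᵐ[fieldMeasure P j G] old') :
    normTerm s new old =ᵐ[fieldMeasure P j G] normTerm s new' old' := by
  filter_upwards [hn, fibreIntegral_congr_ae s hn, fibreIntegral_congr_ae s ho] with V h1 h2 h3
  simp only [normTerm]
  rw [h1, h2, h3]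

/-- The normalised (0.3)-term of a.e.-strongly measurable pieces is a.e.-strongly measurable. [cite: Balaban1989LargeFieldI, (0.3) p.176 (bookkeeping)] -/
theorem aestronglyMeasurable_normTerm (s : Finset (PBond P j)) {new old : Density P j G}
    (hn : AEStronglyMeasurable new (fieldMeasure P j G)) (ho : AEStronglyMeasurable old (fieldMeasure P j G)) :
    AEStronglyMeasurable (normTerm s new old) (fieldMeasure P j G) :=
  (hn.aemeasurable.mul ((aestronglyMeasurable_fibreIntegral s ho).aemeasurable.div
    (aestronglyMeasurable_fibreIntegral s hn).aemeasurable)).aestronglyMeasurable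

/-- **«(0.3) ALMOST EVERYWHERE IN `V`»**: piece families that agree almost everywhere have (0.3) densities `(ℝρ)(V)` that agree almost
everywhere (every numerator and denominator fibre integral moves only on a `dV`-null set, `fibreIntegral_congr_ae`). [cite: Balaban1989LargeFieldI, (0.3) p.176] -/
theorem ropReal_congr_ae {R : Type*} [Fintype R] {piece piece' : R → Density P j G} (pp : R → R)
    (fib : R → Finset (PBond P j)) (h : ∀ Z, piece Z =ᵐ[fieldMeasure P j G] piece' Z) :
    RopReal piece pp fib =ᵐ[fieldMeasure P j G] RopReal piece' pp fib := by
  have hZ : ∀ Z, normTerm (fib Z) (piece (pp Z)) (piece Z) =ᵐ[fieldMeasure P j G] normTerm (fib Z) (piece' (pp Z)) (piece' Z) :=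
    fun Z => normTerm_congr_ae (fib Z) (h (pp Z)) (h Z)
  have hall : ∀ᵐ V ∂(fieldMeasure P j G), ∀ Z, normTerm (fib Z) (piece (pp Z)) (piece Z) V
      = normTerm (fib Z) (piece' (pp Z)) (piece' Z) V := ae_all_iff.2 hZ
  exact hall.mono fun V hV => Finset.sum_congr rfl fun Z _ => hV Z

end SetupAE

/-! ## §2  THE SUPPORT MODIFICATION (layer β): measurable pieces, the support clause ALMOST everywhere -/

section SuppMod

variable {P : Params} {j : ℕ} {G : Type*} [GaugeGroup G] [MeasurableSpace G] [HaarData G]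
variable [DecidableEq (PBond P j)]

open Classical in
/-- **THE SUPPORT MODIFICATION of `old` along the denominator fibre integral of `new`**: `old` set to `0` at the base points `V` where
`∫dV⌈_{Z′} new (V) = 0`.  Under the A.E. support clause it is an a.e.-modification of `old` (`suppMod_ae_eq`) that satisfies the POINTWISE
clause (`suppMod_of_eq_zero`) and leaves the normalised term unchanged everywhere (`normTerm_suppMod`). [cite: Balaban1989LargeFieldI, (0.3) p.176 («hence the denominators are positive», support reading)] -/
def suppMod (s : Finset (PBond P j)) (new old : Density P j G) : Density P j G :=
  fun V => if fibreIntegral s new V = 0 then 0 else old V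

/-- Where the denominator fibre integral vanishes the modification is `0`. [cite: Balaban1989LargeFieldI, (0.3) p.176 (bookkeeping)] -/
theorem suppMod_of_eq_zero (s : Finset (PBond P j)) (new old : Density P j G) {V : GaugeField P j G}
    (hV : fibreIntegral s new V = 0) : suppMod s new old V = 0 := by
  simp [suppMod, hV]

/-- Elsewhere the modification is `old`. [cite: Balaban1989LargeFieldI, (0.3) p.176 (bookkeeping)] -/
theorem suppMod_of_ne_zero (s : Finset (PBond P j)) (new old : Density P j G) {V : GaugeField P j G}
    (hV : fibreIntegral s new V ≠ 0) : suppMod s new old V = old V := by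
  simp [suppMod, hV]

/-- The modification of a measurable `old` along a measurable `new` is measurable. [cite: Balaban1989LargeFieldI, (0.3) p.176 (bookkeeping)] -/
theorem measurable_suppMod (s : Finset (PBond P j)) {new old : Density P j G} (hnew_m : Measurable new)
    (hold_m : Measurable old) : Measurable (suppMod s new old) :=
  Measurable.ite (measurableSet_eq_fun (measurable_fibreIntegral s hnew_m) measurable_const) measurable_const hold_m

/-- `0 ≤ suppMod` for `0 ≤ old`. [cite: Balaban1989LargeFieldI, (0.3) p.176 (bookkeeping)] -/
theorem suppMod_nonneg (s : Finset (PBond P j)) (new : Density P j G) {old : Density P j G} (hold0 : ∀ V, 0 ≤ old V)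
    (V : GaugeField P j G) : 0 ≤ suppMod s new old V := by
  unfold suppMod
  split_ifs
  exacts [le_rfl, hold0 V]

/-- `suppMod ≤ C` for `old ≤ C`, `0 ≤ C`. [cite: Balaban1989LargeFieldI, (0.3) p.176 (bookkeeping)] -/
theorem suppMod_le (s : Finset (PBond P j)) (new : Density P j G) {old : Density P j G} {C : ℝ} (hC0 : 0 ≤ C)
    (holdC : ∀ V, old V ≤ C) (V : GaugeField P j G) : suppMod s new old V ≤ C := by
  unfold suppMod
  split_ifs
  exacts [hC0, holdC V]

/-- **Off the zero set of the denominator the modification has the same fibre integral as `old`**: the fibre integral of `new` is constant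
along the fibre through `V` (n10-b `fibreIntegral_updateFinset`), so on that whole fibre `suppMod = old`. [cite: Balaban1989LargeFieldI, (0.3) p.176 (bookkeeping)] -/
theorem fibreIntegral_suppMod (s : Finset (PBond P j)) (new old : Density P j G) {V : GaugeField P j G}
    (hV : fibreIntegral s new V ≠ 0) : fibreIntegral s (suppMod s new old) V = fibreIntegral s old V := by
  simp only [fibreIntegral, lmarginal]
  congr 1
  refine lintegral_congr fun y => ?_
  rw [suppMod_of_ne_zero s new old (by rw [fibreIntegral_updateFinset]; exact hV)]

/-- **THE NORMALISED TERM DOES NOT SEE THE MODIFICATION**: `normTerm s new (suppMod s new old) = normTerm s new old` EVERYWHERE — where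
`∫dV⌈_s new (V) = 0` both sides are `new(V)·(_ ∕ 0) = 0` (real division), elsewhere `fibreIntegral_suppMod`. [cite: Balaban1989LargeFieldI, (0.3) p.176 (bookkeeping)] -/
theorem normTerm_suppMod (s : Finset (PBond P j)) (new old : Density P j G) :
    normTerm s new (suppMod s new old) = normTerm s new old := by
  funext V
  by_cases hV : fibreIntegral s new V = 0
  · simp only [normTerm, hV, div_zero]
  · simp only [normTerm, fibreIntegral_suppMod s new old hV]

/-- **Under the A.E. support clause the modification IS `old` almost everywhere.** [cite: Balaban1989LargeFieldI, (0.3) p.176 (bookkeeping)] -/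
theorem suppMod_ae_eq (s : Finset (PBond P j)) {new old : Density P j G}
    (hsupp : ∀ᵐ V ∂(fieldMeasure P j G), fibreIntegral s new V = 0 → old V = 0) :
    suppMod s new old =ᵐ[fieldMeasure P j G] old :=
  hsupp.mono fun V hV => by
    by_cases h0 : fibreIntegral s new V = 0
    · rw [suppMod_of_eq_zero s new old h0, hV h0]
    · rw [suppMod_of_ne_zero s new old h0]

/-- **(1.102) for one renormalised component, support clause ALMOST EVERYWHERE** — n10-b's `integral_normTerm_eq_supp` with its pointwise
hypothesis `∀ V, fibreIntegral s new V = 0 → old V = 0` weakened to `dV`-almost every `V` (the other hypotheses unchanged): run n10-b's theorem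
on `suppMod s new old` (measurable, pointwise clause, same normalised term) and come back along `suppMod_ae_eq`.
[cite: Balaban1989LargeFieldI, (1.102) p.201; Balaban1989LargeFieldI, (0.4) p.176] -/
theorem integral_normTerm_eq_suppAE (s : Finset (PBond P j)) {new old : Density P j G}
    (hnew_m : Measurable new) (hold_m : Measurable old) (hnew0 : ∀ V, 0 ≤ new V) (hold0 : ∀ V, 0 ≤ old V)
    {C : ℝ} (hnewC : ∀ V, new V ≤ C) (holdC : ∀ V, old V ≤ C)
    (hsupp : ∀ᵐ V ∂(fieldMeasure P j G), fibreIntegral s new V = 0 → old V = 0) :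
    ∫ V, normTerm s new old V ∂(fieldMeasure P j G) = ∫ V, old V ∂(fieldMeasure P j G) := by
  have hC0 : 0 ≤ C := (hnew0 1).trans (hnewC 1)
  rw [← normTerm_suppMod s new old,
    integral_normTerm_eq_supp s hnew_m (measurable_suppMod s hnew_m hold_m) hnew0 (suppMod_nonneg s new hold0) hnewC
      (suppMod_le s new hC0 holdC) (fun V hV => suppMod_of_eq_zero s new old hV)]
  exact integral_congr_ae (suppMod_ae_eq s hsupp)

/-- **Integrability of the normalised term needs NO support clause**: for measurable `new, old` with `0 ≤ new ≤ C`, `old ≤ C` the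
normalised term `new·∫dV⌈old ∕ ∫dV⌈new` is `dV`-integrable — n10-b's `integrable_normTerm_supp` run on the support modification
`suppMod s new old`, which satisfies the pointwise support clause BY CONSTRUCTION and has the same normalised term (`normTerm_suppMod`).
(The support clause is what the (0.4) IDENTITY needs, not integrability.) [cite: Balaban1989LargeFieldI, (1.102) p.201 (bookkeeping)] -/
theorem integrable_normTerm_bdd (s : Finset (PBond P j)) {new old : Density P j G}
    (hnew_m : Measurable new) (hold_m : Measurable old) (hnew0 : ∀ V, 0 ≤ new V)
    {C : ℝ} (hnewC : ∀ V, new V ≤ C) (holdC : ∀ V, old V ≤ C) :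
    Integrable (normTerm s new old) (fieldMeasure P j G) := by
  have hC0 : 0 ≤ C := (hnew0 1).trans (hnewC 1)
  rw [← normTerm_suppMod s new old]
  exact integrable_normTerm_supp s hnew_m (measurable_suppMod s hnew_m hold_m) hnew0 hnewC (suppMod_le s new hC0 holdC)
    (fun V hV => suppMod_of_eq_zero s new old hV)

end SuppMod

/-! ## §3  THE ESSENTIAL FORM (layer γ): a.e.-strongly measurable, a.e.-bounded pieces, support clause a.e. -/

section Ess

variable {P : Params} {j : ℕ} {G : Type*} [GaugeGroup G] [MeasurableSpace G] [HaarData G]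

/-- **A CLIPPED MEASURABLE MODIFICATION**: an a.e.-strongly measurable density with `0 ≤ f ≤ C` almost everywhere has a MEASURABLE version
`f′ = max 0 (min C f̃)` (`f̃` a strongly measurable version) with `0 ≤ f′ ≤ max C 0` EVERYWHERE and `f = f′` a.e.  Folklore; the cited display is
where it serves («the densities are positive» read almost everywhere). [cite: Balaban1989LargeFieldI, (0.3) p.176 (measure-theoretic bookkeeping: measurable modification of an a.e.-bounded density)] -/
theorem exists_measurable_modification {f : Density P j G} (hf : AEStronglyMeasurable f (fieldMeasure P j G))
    (h0 : ∀ᵐ V ∂(fieldMeasure P j G), 0 ≤ f V) {C : ℝ} (hC : ∀ᵐ V ∂(fieldMeasure P j G), f V ≤ C) :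
    ∃ f' : Density P j G, Measurable f' ∧ f =ᵐ[fieldMeasure P j G] f' ∧ (∀ V, 0 ≤ f' V) ∧ ∀ V, f' V ≤ max C 0 := by
  refine ⟨fun V => max 0 (min C (hf.mk f V)), ?_, ?_, fun V => le_max_left _ _, fun V => ?_⟩
  · exact measurable_const.max (measurable_const.min hf.stronglyMeasurable_mk.measurable)
  · filter_upwards [hf.ae_eq_mk, h0, hC] with V hV h0V hCV
    rw [← hV, min_eq_right hCV, max_eq_right h0V]
  · exact max_le (le_max_right _ _) ((min_le_left _ _).trans (le_max_left _ _))

variable [DecidableEq (PBond P j)]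

/-- **The a.e. support clause moves across a.e.-equal pieces** (the denominator fibre integrals agree a.e., `fibreIntegral_congr_ae`).
[cite: Balaban1989LargeFieldI, (0.3) p.176 (bookkeeping)] -/
theorem suppClause_congr_ae (s : Finset (PBond P j)) {new new' old old' : Density P j G}
    (hn : new =ᵐ[fieldMeasure P j G] new') (ho : old =ᵐ[fieldMeasure P j G] old')
    (hsupp : ∀ᵐ V ∂(fieldMeasure P j G), fibreIntegral s new V = 0 → old V = 0) :
    ∀ᵐ V ∂(fieldMeasure P j G), fibreIntegral s new' V = 0 → old' V = 0 := by
  filter_upwards [hsupp, fibreIntegral_congr_ae s hn, ho] with V h1 h2 h3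
  intro hV
  rw [← h3]
  exact h1 (by rw [h2]; exact hV)

omit [DecidableEq (PBond P j)] in
/-- An a.e.-bounded a.e.-strongly measurable non-negative density is integrable for `dV` (a probability measure). [cite: Balaban1989LargeFieldI, (0.2) p.176 (bookkeeping: integrability of a.e.-bounded densities)] -/
theorem integrable_of_ae_bdd {f : Density P j G} (hf : AEStronglyMeasurable f (fieldMeasure P j G))
    (h0 : ∀ᵐ V ∂(fieldMeasure P j G), 0 ≤ f V) {C : ℝ} (hC : ∀ᵐ V ∂(fieldMeasure P j G), f V ≤ C) :
    Integrable f (fieldMeasure P j G) :=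
  (integrable_const (max C 0)).mono' hf <| by
    filter_upwards [h0, hC] with V h0V hCV
    rw [Real.norm_eq_abs, abs_of_nonneg h0V]
    exact hCV.trans (le_max_left _ _)

/-- **(0.4) over `Setup`, ESSENTIAL FORM** — b01's `integral_ropReal_eq` ∕ n10-b's `integral_ropReal_eq_supp` with every hypothesis in its
essential form: pieces a.e.-strongly measurable, `0 ≤ ρ(Z,·)` a.e., `ρ(Z,·) ≤ C` a.e., and the support clause *«where `∫dV⌈_{Z′}ρ(Z″,·)`
vanishes, `ρ(Z,·)` vanishes»* a.e.; conclusion `∫dV (ℝρ)(V) = ∫dV Σ_Z ρ(Z, V)` for the ORIGINAL pieces.  Proof: clipped measurable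
modifications (`exists_measurable_modification`), the a.e. clause moved onto them (`suppClause_congr_ae`), layer β termwise, and back along
`normTerm_congr_ae`. [cite: Balaban1989LargeFieldI, (0.4) p.176; Balaban1989LargeFieldI, (1.102) p.201] -/
theorem integral_ropReal_eq_ess {R : Type*} [Fintype R] (piece : R → Density P j G) (pp : R → R)
    (fib : R → Finset (PBond P j)) (hm : ∀ Z, AEStronglyMeasurable (piece Z) (fieldMeasure P j G))
    (h0 : ∀ Z, ∀ᵐ V ∂(fieldMeasure P j G), 0 ≤ piece Z V) {C : ℝ} (hC : ∀ Z, ∀ᵐ V ∂(fieldMeasure P j G), piece Z V ≤ C)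
    (hsupp : ∀ Z, ∀ᵐ V ∂(fieldMeasure P j G), fibreIntegral (fib Z) (piece (pp Z)) V = 0 → piece Z V = 0) :
    ∫ V, RopReal piece pp fib V ∂(fieldMeasure P j G) = ∫ V, ∑ Z, piece Z V ∂(fieldMeasure P j G) := by
  choose piece' hm' hae h0' hC' using fun Z => exists_measurable_modification (hm Z) (h0 Z) (hC Z)
  have hsupp' : ∀ Z, ∀ᵐ V ∂(fieldMeasure P j G), fibreIntegral (fib Z) (piece' (pp Z)) V = 0 → piece' Z V = 0 :=
    fun Z => suppClause_congr_ae (fib Z) (hae (pp Z)) (hae Z) (hsupp Z)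
  have hnt : ∀ Z, normTerm (fib Z) (piece (pp Z)) (piece Z)
      =ᵐ[fieldMeasure P j G] normTerm (fib Z) (piece' (pp Z)) (piece' Z) :=
    fun Z => normTerm_congr_ae (fib Z) (hae (pp Z)) (hae Z)
  have hint : ∀ Z, Integrable (normTerm (fib Z) (piece (pp Z)) (piece Z)) (fieldMeasure P j G) := fun Z =>
    (integrable_normTerm_bdd (fib Z) (hm' _) (hm' _) (h0' _) (hC' _) (hC' _)).congr (hnt Z).symm
  have hpi : ∀ Z, Integrable (piece Z) (fieldMeasure P j G) := fun Z => integrable_of_ae_bdd (hm Z) (h0 Z) (hC Z)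
  simp only [RopReal]
  rw [integral_finsetSum _ (fun Z _ => hint Z), integral_finsetSum _ (fun Z _ => hpi Z)]
  refine Finset.sum_congr rfl fun Z _ => ?_
  rw [integral_congr_ae (hnt Z),
    integral_normTerm_eq_suppAE (fib Z) (hm' _) (hm' _) (h0' _) (h0' _) (hC' _) (hC' _) (hsupp' Z)]
  exact integral_congr_ae (hae Z).symm

/-- **Integrability of (0.3), ESSENTIAL FORM — and NO support clause**: for pieces a.e.-strongly measurable with `0 ≤ ρ(Z,·) ≤ C` almost
everywhere, `ℝρ` is `dV`-integrable (termwise `integrable_normTerm_bdd` on the clipped measurable modifications, transferred along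
`normTerm_congr_ae`; the support clause is needed for the (0.4) identity only). [cite: Balaban1989LargeFieldI, (0.3)–(0.4) p.176 (bookkeeping)] -/
theorem integrable_ropReal_ess {R : Type*} [Fintype R] (piece : R → Density P j G) (pp : R → R)
    (fib : R → Finset (PBond P j)) (hm : ∀ Z, AEStronglyMeasurable (piece Z) (fieldMeasure P j G))
    (h0 : ∀ Z, ∀ᵐ V ∂(fieldMeasure P j G), 0 ≤ piece Z V) {C : ℝ} (hC : ∀ Z, ∀ᵐ V ∂(fieldMeasure P j G), piece Z V ≤ C) :
    Integrable (RopReal piece pp fib) (fieldMeasure P j G) := by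
  choose piece' hm' hae h0' hC' using fun Z => exists_measurable_modification (hm Z) (h0 Z) (hC Z)
  have hint : ∀ Z, Integrable (normTerm (fib Z) (piece (pp Z)) (piece Z)) (fieldMeasure P j G) := fun Z =>
    (integrable_normTerm_bdd (fib Z) (hm' _) (hm' _) (h0' _) (hC' _) (hC' _)).congr
      (normTerm_congr_ae (fib Z) (hae (pp Z)) (hae Z)).symm
  have hR : RopReal piece pp fib = fun V => ∑ Z, normTerm (fib Z) (piece (pp Z)) (piece Z) V := rfl
  rw [hR]
  exact integrable_finsetSum _ fun Z _ => hint Z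

/-- **`0 ≤ ℝρ` almost everywhere** for pieces non-negative almost everywhere (quotients of fibre integrals are `toReal`s, hence `≥ 0`).
[cite: Balaban1989LargeFieldI, (0.3) p.176 («the densities are positive», weak form)] -/
theorem ropReal_nonneg_ae {R : Type*} [Fintype R] (piece : R → Density P j G) (pp : R → R)
    (fib : R → Finset (PBond P j)) (h0 : ∀ Z, ∀ᵐ V ∂(fieldMeasure P j G), 0 ≤ piece Z V) :
    ∀ᵐ V ∂(fieldMeasure P j G), 0 ≤ RopReal piece pp fib V := by
  have hall : ∀ᵐ V ∂(fieldMeasure P j G), ∀ Z, 0 ≤ piece Z V := ae_all_iff.2 h0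
  refine hall.mono fun V hV => Finset.sum_nonneg fun Z _ => ?_
  unfold normTerm fibreIntegral
  exact mul_nonneg (hV _) (div_nonneg ENNReal.toReal_nonneg ENNReal.toReal_nonneg)

end Ess

end Literature.MathematicalPhysics.QuantumFieldTheory.Balaban1983to89.B15.BasicStep

/-! ## §4  THE DATUM: the essential-form provisos of a representation datum and their certificates -/

namespace Literature.MathematicalPhysics.QuantumFieldTheory.Balaban1983to89.B15RopTotal

open B15.BasicStep (fibreIntegral normTerm RopReal integral_ropReal_eq_ess integrable_ropReal_ess ropReal_nonneg_ae
  integrable_of_ae_bdd)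

variable {P : Params} {j : ℕ} {G : Type*} [GaugeGroup G] [MeasurableSpace G] [HaarData G]

namespace RepData

variable (d : RepData P j G)

/-- **THE PROVISOS OF p. 176 IN ESSENTIAL FORM** for the datum: every piece `ρ(Z,·)` A.E.-STRONGLY MEASURABLE for `dV`, `0 ≤ ρ(Z,·)`
ALMOST EVERYWHERE, uniformly bounded ALMOST EVERYWHERE (`∃ C, ∀ Z, ρ(Z,·) ≤ C` a.e.), and the support reading of *«the denominators are
positive»* ALMOST EVERYWHERE: for `dV`-a.e. `V`, if `∫dV⌈_{Z′}ρ(Z″,·)` vanishes at `V` then `ρ(Z, V) = 0`.  n10-b's `ProvisosSupp` with each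
conjunct in its essential form; a `Prop` with body about the datum (no fact is named). [cite: Balaban1989LargeFieldI, (0.3) p.176] -/
def ProvisosEss [DecidableEq (PBond P j)] : Prop :=
  (∀ Z, AEStronglyMeasurable (d.piece Z) (fieldMeasure P j G)) ∧ (∀ Z, ∀ᵐ V ∂(fieldMeasure P j G), 0 ≤ d.piece Z V) ∧
    (∃ C : ℝ, ∀ Z, ∀ᵐ V ∂(fieldMeasure P j G), d.piece Z V ≤ C) ∧
    ∀ Z, ∀ᵐ V ∂(fieldMeasure P j G), fibreIntegral (d.fib Z) (d.piece (d.pp Z)) V = 0 → d.piece Z V = 0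

/-- The support-form provisos (as typed, pointwise) imply the essential form. [cite: Balaban1989LargeFieldI, (0.3) p.176 (bookkeeping)] -/
theorem provisosEss_of_provisosSupp [DecidableEq (PBond P j)] (h : d.ProvisosSupp) : d.ProvisosEss :=
  ⟨fun Z => (h.1 Z).aestronglyMeasurable, fun Z => ae_of_all _ (h.2.1 Z),
    ⟨h.2.2.1.choose, fun Z => ae_of_all _ (h.2.2.1.choose_spec Z)⟩, fun Z => ae_of_all _ (h.2.2.2 Z)⟩

/-- The standard provisos imply the essential form. [cite: Balaban1989LargeFieldI, (0.3) p.176 (bookkeeping)] -/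
theorem provisosEss_of_provisos [DecidableEq (PBond P j)] (h : d.Provisos) : d.ProvisosEss :=
  d.provisosEss_of_provisosSupp (d.provisosSupp_of_provisos h)

/-- **(0.4) FOR THE DATUM under the essential-form provisos**: `∫dV (𝐑ρ)(V) = ∫dV ρ(V)` with `𝐑ρ = d.rop`, `ρ = d.total`
(`integral_ropReal_eq_ess` at the datum's own `Fintype` structure). [cite: Balaban1989LargeFieldI, (0.4) p.176] -/
theorem integral_rop_eq_of_provisosEss [DecidableEq (PBond P j)] (h : d.ProvisosEss) :
    ∫ V, d.rop V ∂(fieldMeasure P j G) = ∫ V, d.total V ∂(fieldMeasure P j G) := by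
  letI := d.fin
  obtain ⟨hm, h0, ⟨C, hC⟩, hsupp⟩ := h
  exact integral_ropReal_eq_ess d.piece d.pp d.fib hm h0 hC hsupp

/-- **Integrability of (0.3) of the datum** under the essential-form provisos (conjuncts 1–3 only; the support clause is not used). [cite: Balaban1989LargeFieldI, (0.3)–(0.4) p.176 (bookkeeping)] -/
theorem integrable_rop_of_provisosEss [DecidableEq (PBond P j)] (h : d.ProvisosEss) : Integrable d.rop (fieldMeasure P j G) := by
  letI := d.fin
  obtain ⟨hm, h0, ⟨C, hC⟩, -⟩ := h
  exact integrable_ropReal_ess d.piece d.pp d.fib hm h0 hC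

/-- `0 ≤ 𝐑ρ` almost everywhere under the essential-form provisos. [cite: Balaban1989LargeFieldI, (0.3) p.176 (bookkeeping)] -/
theorem rop_nonneg_ae_of_provisosEss [DecidableEq (PBond P j)] (h : d.ProvisosEss) :
    ∀ᵐ V ∂(fieldMeasure P j G), 0 ≤ d.rop V := by
  letI := d.fin
  exact ropReal_nonneg_ae d.piece d.pp d.fib h.2.1

/-- The represented density `Σ_Z ρ(Z,·)` is integrable under the essential-form provisos. [cite: Balaban1989LargeFieldI, (0.2) p.176 (bookkeeping)] -/
theorem integrable_total_of_provisosEss [DecidableEq (PBond P j)] (h : d.ProvisosEss) :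
    Integrable d.total (fieldMeasure P j G) := by
  letI := d.fin
  obtain ⟨hm, h0, ⟨C, hC⟩, -⟩ := h
  have ht : d.total = fun V => ∑ Z, d.piece Z V := rfl
  rw [ht]
  exact integrable_finsetSum _ fun Z _ => integrable_of_ae_bdd (hm Z) (h0 Z) (hC Z)

end RepData

end Literature.MathematicalPhysics.QuantumFieldTheory.Balaban1983to89.B15RopTotal

/-! ## §5  THE FORM AND THE PINS -/

namespace Literature.MathematicalPhysics.QuantumFieldTheory.Balaban1983to89.Node00

open T4Continuum B15RopTotal
open B15.BasicStep (fibreIntegral normTerm RopReal)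

section Form

variable {P : Params} {j : ℕ} {G : Type*} [GaugeGroup G] [MeasurableSpace G] [HaarData G]

/-- `ProvisosEss` does not depend on the `DecidableEq (PBond P j)` instance (TS-8). [cite: Balaban1989LargeFieldI, (0.3) p.176 (bookkeeping)] -/
theorem provisosEss_instIrrel (i₁ i₂ : DecidableEq (PBond P j)) (d : RepData P j G) :
    (haveI := i₁; d.ProvisosEss) ↔ (haveI := i₂; d.ProvisosEss) := by
  cases Subsingleton.elim i₁ i₂
  exact Iff.rfl

variable [DecidableEq (PBond P j)]

/-- **THE ESSENTIAL FORM** — the third proviso form beside FILE 9′'s `.std` ∕ `.supp`: predicate `RepData.ProvisosEss`, certificates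
`integral_rop_eq_of_provisosEss` ((0.4) for the datum) and `integrable_rop_of_provisosEss` (both PROVED, §3–§4). [cite: Balaban1989LargeFieldI, (0.3)–(0.4) p.176] -/
def ProvisoForm.ess : ProvisoForm P j G where
  Prov d := d.ProvisosEss
  integral_rop_eq d h := d.integral_rop_eq_of_provisosEss h
  integrable_rop d h := d.integrable_rop_of_provisosEss h

/-- The essential form's predicate is `RepData.ProvisosEss`. [cite: Balaban1989LargeFieldI, (0.3) p.176 (bookkeeping)] -/
theorem ProvisoForm.ess_prov_iff (d : RepData P j G) :
    (ProvisoForm.ess : ProvisoForm P j G).Prov d ↔ d.ProvisosEss := Iff.rfl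

/-- The support form implies the essential form. [cite: Balaban1989LargeFieldI, (0.3) p.176 (bookkeeping)] -/
theorem ProvisoForm.ess_of_supp (d : RepData P j G) (h : (ProvisoForm.supp : ProvisoForm P j G).Prov d) :
    (ProvisoForm.ess : ProvisoForm P j G).Prov d :=
  d.provisosEss_of_provisosSupp h

/-- The standard form implies the essential form. [cite: Balaban1989LargeFieldI, (0.3) p.176 (bookkeeping)] -/
theorem ProvisoForm.ess_of_std (d : RepData P j G) (h : (ProvisoForm.std : ProvisoForm P j G).Prov d) :
    (ProvisoForm.ess : ProvisoForm P j G).Prov d :=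
  d.provisosEss_of_provisos h

/-- v1.3 is admissible wherever v1.2 is (one lattice). [cite: Balaban1989LargeFieldI, (0.3) p.176 (bookkeeping)] -/
theorem admissibleBy_ess_of_supp {rep : Density P j G → RepData P j G} {ρ : Density P j G}
    (h : AdmissibleBy ProvisoForm.supp rep ρ) : AdmissibleBy ProvisoForm.ess rep ρ :=
  h.mono fun d hd => ProvisoForm.ess_of_supp d hd

/-- **On the admissible branch over the essential form `R ρ ≥ 0` a.e.; off it `R ρ = ρ`**: `R` over the essential form preserves a.e.
non-negativity. [cite: Balaban1989LargeFieldI, (0.3) p.176 («the densities are positive», weak form)] -/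
theorem ropTotalBy_ess_nonneg_ae (rep : Density P j G → RepData P j G) {ρ : Density P j G}
    (hρ : ∀ᵐ V ∂(fieldMeasure P j G), 0 ≤ ρ V) : ∀ᵐ V ∂(fieldMeasure P j G), 0 ≤ ropTotalBy ProvisoForm.ess rep ρ V := by
  by_cases h : AdmissibleBy ProvisoForm.ess rep ρ
  · rw [ropTotalBy_of_admissible h]
    exact (rep ρ).rop_nonneg_ae_of_provisosEss h.2
  · rw [ropTotalBy_of_not h]
    exact hρ

end Form

section FormInstIrrel

variable {P : Params} {j : ℕ} {G : Type*} [GaugeGroup G] [MeasurableSpace G] [HaarData G]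

/-- Admissibility over the essential form does not depend on the instance. [cite: Balaban1989LargeFieldI, (0.3) p.176 (bookkeeping)] -/
theorem admissibleBy_ess_instIrrel (i₁ i₂ : DecidableEq (PBond P j)) (rep : Density P j G → RepData P j G) (ρ : Density P j G) :
    (haveI := i₁; AdmissibleBy ProvisoForm.ess rep ρ) ↔ (haveI := i₂; AdmissibleBy ProvisoForm.ess rep ρ) := by
  cases Subsingleton.elim i₁ i₂
  exact Iff.rfl

/-- `ropTotalBy` over the essential form does not depend on the instance. [cite: Balaban1989LargeFieldI, (0.3) p.176 (bookkeeping)] -/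
theorem ropTotalBy_ess_instIrrel (i₁ i₂ : DecidableEq (PBond P j)) (rep : Density P j G → RepData P j G) :
    (haveI := i₁; ropTotalBy ProvisoForm.ess rep) = (haveI := i₂; ropTotalBy ProvisoForm.ess rep) := by
  cases Subsingleton.elim i₁ i₂
  rfl

end FormInstIrrel

/-! ### The NODE 00 pins over the essential form (v1.3, OFFERED — the plug of record stays v1.2 `ROp03SuppOfRecord`) -/

section Pin

variable (F : T4Family) (N : ℕ) [NeZero N]

open Classical in
/-- The essential form at every run and step. [cite: Balaban1989LargeFieldI, (0.3) p.176 (bookkeeping)] -/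
def ProvisoFormOfRecord.ess : ProvisoFormOfRecord F N := fun _ _ => ProvisoForm.ess

/-- **`R` OF RECORD OVER THE ESSENTIAL FORM (v1.3)** at the residual datum `rep` = FILE 9′'s pin `ROp03ByOfRecord` at `ProvisoFormOfRecord.ess`:
(0.3) of the datum on the densities admissible over the ESSENTIAL provisos, the identity elsewhere.  Offered beside the plug of record v1.2
(`ROp03SuppOfRecord`); admissible wherever v1.2 is (`admissibleBy_ess_of_supp`) and also on data whose pieces are only a.e.-strongly
measurable ∕ a.e.-bounded. [cite: Balaban1989LargeFieldI, (0.3) p.176] -/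
def ROp03EssOfRecord (rep : RepOfRecord F N) (p : B12.RunParams) (k : ℕ) :
    Density (F.P p.K) (k + 1) (SU N) → Density (F.P p.K) (k + 1) (SU N) :=
  ROp03ByOfRecord F N (ProvisoFormOfRecord.ess F N) rep p k

/-- Unfolding of v1.3. [cite: Balaban1989LargeFieldI, (0.3) p.176 (bookkeeping)] -/
theorem ROp03EssOfRecord_eq (rep : RepOfRecord F N) :
    ROp03EssOfRecord F N rep = ROp03ByOfRecord F N (ProvisoFormOfRecord.ess F N) rep := rfl

/-- v1.3 at ANY instance: `ropTotalBy ProvisoForm.ess` of the datum read with the consumer's instance (TS-8 (iii)). [cite: Balaban1989LargeFieldI, (0.3) p.176 (bookkeeping)] -/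
theorem ROp03EssOfRecord_eq_ropTotalBy (rep : RepOfRecord F N) (p : B12.RunParams) (k : ℕ) [DecidableEq (PBond (F.P p.K) (k + 1))] :
    ROp03EssOfRecord F N rep p k = ropTotalBy ProvisoForm.ess (rep p k) :=
  ropTotalBy_ess_instIrrel _ _ (rep p k)

/-- **(0.4) for v1.3, every run, step and density** (`Residual₅.preservesIntegral_R` shape; guard unused). [cite: Balaban1989LargeFieldI, (0.4) p.176] -/
theorem preservesIntegral_ROp03EssOfRecord (rep : RepOfRecord F N) :
    ∀ (p : B12.RunParams) (k : ℕ), k < p.K → PreservesIntegral (ROp03EssOfRecord F N rep p k) :=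
  preservesIntegral_ROp03ByOfRecord F N _ rep

/-- (0.4) for v1.3 without the guard. [cite: Balaban1989LargeFieldI, (0.4) p.176] -/
theorem preservesIntegral_ROp03EssOfRecord' (rep : RepOfRecord F N) (p : B12.RunParams) (k : ℕ) :
    PreservesIntegral (ROp03EssOfRecord F N rep p k) :=
  preservesIntegral_ROp03ByOfRecord' F N _ rep p k

/-- **Integrability is preserved by v1.3** (`Residual₅.integrable_R` shape). [cite: Balaban1989LargeFieldI, (0.3)–(0.4) p.176 (bookkeeping)] -/
theorem integrable_ROp03EssOfRecord (rep : RepOfRecord F N) :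
    ∀ (p : B12.RunParams) (k : ℕ), k < p.K → ∀ ρ : Density (F.P p.K) (k + 1) (SU N),
      Integrable ρ (fieldMeasure (F.P p.K) (k + 1) (SU N)) →
        Integrable (ROp03EssOfRecord F N rep p k ρ) (fieldMeasure (F.P p.K) (k + 1) (SU N)) :=
  integrable_ROp03ByOfRecord F N _ rep

/-- v1.3 on its admissible branch, at the consumer's instance. [cite: Balaban1989LargeFieldI, (0.3) p.176 (bookkeeping)] -/
theorem ROp03EssOfRecord_of_admissibleBy {rep : RepOfRecord F N} {p : B12.RunParams} {k : ℕ} [DecidableEq (PBond (F.P p.K) (k + 1))]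
    {ρ : Density (F.P p.K) (k + 1) (SU N)} (h : AdmissibleBy ProvisoForm.ess (rep p k) ρ) :
    ROp03EssOfRecord F N rep p k ρ = (rep p k ρ).rop := by
  rw [ROp03EssOfRecord_eq_ropTotalBy]
  exact ropTotalBy_of_admissible h

/-- v1.3 off its admissible branch, at the consumer's instance. [cite: Balaban1989LargeFieldI, (0.3) p.176 (typing convention)] -/
theorem ROp03EssOfRecord_of_not {rep : RepOfRecord F N} {p : B12.RunParams} {k : ℕ} [DecidableEq (PBond (F.P p.K) (k + 1))]
    {ρ : Density (F.P p.K) (k + 1) (SU N)} (h : ¬ AdmissibleBy ProvisoForm.ess (rep p k) ρ) :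
    ROp03EssOfRecord F N rep p k ρ = ρ := by
  rw [ROp03EssOfRecord_eq_ropTotalBy]
  exact ropTotalBy_of_not h

/-- **v1.3 preserves a.e. non-negativity** (every run and step, consumer's instance). [cite: Balaban1989LargeFieldI, (0.3) p.176 («the densities are positive», weak form)] -/
theorem ROp03EssOfRecord_nonneg_ae (rep : RepOfRecord F N) (p : B12.RunParams) (k : ℕ) [DecidableEq (PBond (F.P p.K) (k + 1))]
    {ρ : Density (F.P p.K) (k + 1) (SU N)} (hρ : ∀ᵐ V ∂(fieldMeasure (F.P p.K) (k + 1) (SU N)), 0 ≤ ρ V) :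
    ∀ᵐ V ∂(fieldMeasure (F.P p.K) (k + 1) (SU N)), 0 ≤ ROp03EssOfRecord F N rep p k ρ V := by
  rw [ROp03EssOfRecord_eq_ropTotalBy]
  exact ropTotalBy_ess_nonneg_ae (rep p k) hρ

end Pin

/-! ## §6  GENERIC (2.18) FACES: the essential provisos of `repDataOfSel r sel fib` on the summands `t_a = χ(a)·(𝐓e^{A})(a)` -/

section Generic218

variable {P : Params} {j : ℕ} {G : Type*} [GaugeGroup G] [MeasurableSpace G] [HaarData G] [DecidableEq (PBond P j)]

/-- The ESSENTIAL provisos of the R-step datum of a (2.18) representation, written out on the summands `t_a` (`Iff.rfl`).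
[cite: Balaban1989LargeFieldI, (0.3) p.176; Balaban1988Convergent, (2.18) p.257] -/
theorem provisosEss_repDataOfSel_iff (r : Step.Repr218 P G j) (sel : r.Adm → r.Adm) (fib : r.Adm → Finset (PBond P j)) :
    (repDataOfSel r sel fib).ProvisosEss ↔
      (∀ a, AEStronglyMeasurable (rterm r a) (fieldMeasure P j G)) ∧ (∀ a, ∀ᵐ V ∂(fieldMeasure P j G), 0 ≤ rterm r a V) ∧
        (∃ C : ℝ, ∀ a, ∀ᵐ V ∂(fieldMeasure P j G), rterm r a V ≤ C) ∧
        ∀ a, ∀ᵐ V ∂(fieldMeasure P j G), fibreIntegral (fib a) (rterm r (sel a)) V = 0 → rterm r a V = 0 :=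
  Iff.rfl

/-- **SUFFICIENT A.E. CONDITIONS ON THE FACTORS**: `χ(a)` and the slot a.e.-strongly measurable, `0 ≤ χ(a) ≤ 1` (pointwise — products of
characteristic functions), `0 ≤ slot` a.e., `slot ≤ C` a.e. uniformly in `a`, and the support clause on the factors a.e. give the essential
provisos of the R-step datum. [cite: Balaban1989LargeFieldI, (0.3) p.176; Balaban1988Convergent, (2.17)–(2.18) p.257] -/
theorem provisosEss_repDataOfSel_of_factors_ae (r : Step.Repr218 P G j) (sel : r.Adm → r.Adm) (fib : r.Adm → Finset (PBond P j))
    (hχm : ∀ a, AEStronglyMeasurable (r.χ a) (fieldMeasure P j G)) (hTm : ∀ a, AEStronglyMeasurable (r.TexpA a) (fieldMeasure P j G))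
    (hχ0 : ∀ a V, 0 ≤ r.χ a V) (hχ1 : ∀ a V, r.χ a V ≤ 1)
    (hT0 : ∀ a, ∀ᵐ V ∂(fieldMeasure P j G), 0 ≤ r.TexpA a V) (hTC : ∃ C : ℝ, ∀ a, ∀ᵐ V ∂(fieldMeasure P j G), r.TexpA a V ≤ C)
    (hsupp : ∀ a, ∀ᵐ V ∂(fieldMeasure P j G),
      fibreIntegral (fib a) (rterm r (sel a)) V = 0 → r.χ a V = 0 ∨ r.TexpA a V = 0) :
    (repDataOfSel r sel fib).ProvisosEss := by
  refine ⟨fun a => (hχm a).mul (hTm a), fun a => ?_, ?_, fun a => ?_⟩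
  · filter_upwards [hT0 a] with V hV
    exact mul_nonneg (hχ0 a V) hV
  · obtain ⟨C, hC⟩ := hTC
    refine ⟨C, fun a => ?_⟩
    filter_upwards [hT0 a, hC a] with V h0V hCV
    exact (mul_le_of_le_one_left h0V (hχ1 a V)).trans hCV
  · filter_upwards [hsupp a] with V hV h
    show r.χ a V * r.TexpA a V = 0
    rcases hV h with h0 | h0
    · rw [h0, zero_mul]
    · rw [h0, mul_zero]

end Generic218

/-! ## §7  TOWER-OF-RECORD FACES (consumer's instance): the essential provisos of the tower's R-step data, (0.4) and integrability at a
slot family under them, and v1.3 at the tower -/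

section Record

variable (F : T4Family) (N : ℕ) [NeZero N] (ν : Stage7Numerics) (τ : TowerNumerics)

/-- **THE ESSENTIAL (0.3) PROVISOS OF THE TOWER OF RECORD, WRITTEN OUT** on the slot family `texpA` (consumer's instance): the summands
`χ_k(s)·slot(s)` a.e.-strongly measurable, `≥ 0` a.e., ESSENTIALLY UNIFORMLY BOUNDED — conjunct 3 IS dag-n23-b's `EssBddPiecesOfRecord` —
and the support clause a.e.  `Iff.rfl`. [cite: Balaban1989LargeFieldI, (0.3) p.176] -/
theorem provisosEss_towerRepOfRecord_iff (texpA : TexpAOfRecord F N ν τ.M) (ppSel : PpSelOfRecord F ν τ.M)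
    (p : B12.RunParams) (g : ℕ → ℝ) (k : ℕ) [DecidableEq (PBond (F.P p.K) k)] :
    (towerRepOfRecord F N ν τ texpA ppSel p g k).toRepData.ProvisosEss ↔
      (∀ s, AEStronglyMeasurable (fun V => chiSeqOfRecord F N ν τ.M g p.K k s V * texpA p g k s V)
        (fieldMeasure (F.P p.K) k (SU N))) ∧
      (∀ s, ∀ᵐ V ∂(fieldMeasure (F.P p.K) k (SU N)), 0 ≤ chiSeqOfRecord F N ν τ.M g p.K k s V * texpA p g k s V) ∧
      EssBddPiecesOfRecord F N ν τ.M texpA p g k ∧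
      ∀ s, ∀ᵐ V ∂(fieldMeasure (F.P p.K) k (SU N)), fibreIntegral (fibOfSeq F ν τ p g k s)
          (fun V => chiSeqOfRecord F N ν τ.M g p.K k (ppSel p g k s) V * texpA p g k (ppSel p g k s) V) V = 0 →
        chiSeqOfRecord F N ν τ.M g p.K k s V * texpA p g k s V = 0 :=
  Iff.rfl

/-- FILE 10's support-form provisos of the tower of record (as typed) imply the essential ones. [cite: Balaban1989LargeFieldI, (0.3) p.176 (bookkeeping)] -/
theorem provisosEss_towerRepOfRecord_of_provisosSupp (texpA : TexpAOfRecord F N ν τ.M) (ppSel : PpSelOfRecord F ν τ.M)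
    (p : B12.RunParams) (g : ℕ → ℝ) (k : ℕ) [DecidableEq (PBond (F.P p.K) k)]
    (h : (towerRepOfRecord F N ν τ texpA ppSel p g k).toRepData.ProvisosSupp) :
    (towerRepOfRecord F N ν τ texpA ppSel p g k).toRepData.ProvisosEss :=
  RepData.provisosEss_of_provisosSupp _ h

/-- **THE ESSENTIAL PROVISOS OF THE TOWER OF RECORD FROM DISPLAYED A.E. SLOT PROPERTIES**: `χ_k(s)` of record and the slots a.e.-strongly
measurable, `0 ≤ slot(s)` a.e., `slot(s) ≤ C` a.e. uniformly in `s`, and the support clause on the factors a.e. (`0 ≤ χ_k(s) ≤ 1` everywhere is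
FILE 10's `chiSeqOfRecord_nonneg` ∕ `_le_one`). [cite: Balaban1989LargeFieldI, (0.3) p.176; Balaban1988Convergent, (2.17)–(2.18) p.257] -/
theorem provisosEss_towerRepOfRecord_of_slots_ae (texpA : TexpAOfRecord F N ν τ.M) (ppSel : PpSelOfRecord F ν τ.M)
    (p : B12.RunParams) (g : ℕ → ℝ) (k : ℕ) [DecidableEq (PBond (F.P p.K) k)]
    (hχm : ∀ s, AEStronglyMeasurable (chiSeqOfRecord F N ν τ.M g p.K k s) (fieldMeasure (F.P p.K) k (SU N)))
    (hTm : ∀ s, AEStronglyMeasurable (texpA p g k s) (fieldMeasure (F.P p.K) k (SU N)))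
    (hT0 : ∀ s, ∀ᵐ V ∂(fieldMeasure (F.P p.K) k (SU N)), 0 ≤ texpA p g k s V)
    (hTC : ∃ C : ℝ, ∀ s, ∀ᵐ V ∂(fieldMeasure (F.P p.K) k (SU N)), texpA p g k s V ≤ C)
    (hsupp : ∀ s, ∀ᵐ V ∂(fieldMeasure (F.P p.K) k (SU N)), fibreIntegral (fibOfSeq F ν τ p g k s)
        (fun V => chiSeqOfRecord F N ν τ.M g p.K k (ppSel p g k s) V * texpA p g k (ppSel p g k s) V) V = 0 →
      chiSeqOfRecord F N ν τ.M g p.K k s V = 0 ∨ texpA p g k s V = 0) :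
    (towerRepOfRecord F N ν τ texpA ppSel p g k).toRepData.ProvisosEss :=
  provisosEss_repDataOfSel_of_factors_ae (repr218OfRecord F N ν τ.M texpA p g k) (ppSel p g k) (fibOfSeq F ν τ p g k) hχm hTm
    (fun s V => chiSeqOfRecord_nonneg F N ν τ.M g p.K k s V) (fun s V => chiSeqOfRecord_le_one F N ν τ.M g p.K k s V) hT0 hTC hsupp

/-- **ZERO SLOT FAMILY: the essential provisos of the tower of record HOLD** (junk inhabitant, through FILE 10's support-form one; plan's K0
direction). [cite: Balaban1989LargeFieldI, (0.3) p.176 (bookkeeping)] -/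
theorem provisosEss_towerRepOfRecord_of_slot_eq_zero (texpA : TexpAOfRecord F N ν τ.M) (ppSel : PpSelOfRecord F ν τ.M)
    (p : B12.RunParams) (g : ℕ → ℝ) (k : ℕ) [DecidableEq (PBond (F.P p.K) k)] (h0 : ∀ s V, texpA p g k s V = 0) :
    (towerRepOfRecord F N ν τ texpA ppSel p g k).toRepData.ProvisosEss :=
  provisosEss_towerRepOfRecord_of_provisosSupp F N ν τ texpA ppSel p g k
    (provisosSupp_towerRepOfRecord_of_slot_eq_zero F N ν τ texpA ppSel p g k h0)

/-- **(0.4) AT A SLOT FAMILY UNDER THE ESSENTIAL FORM**: under `ProvisosEss` of the tower of record at level `k`, the slice density of the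
R-stepped slot and the represented density of the slot have equal integrals (`integral_rop_eq_of_provisosEss` at the tower datum, whose (0.3)
is the slice density of the R-stepped slot (FILE 8) and whose total is the represented density (FILE 5, `rfl`)). [cite: Balaban1989LargeFieldI, (0.4) p.176] -/
theorem integral_densityOfSlice_rstepSlotOfRecord_of_provisosEss (texpA : TexpAOfRecord F N ν τ.M) (ppSel : PpSelOfRecord F ν τ.M)
    (p : B12.RunParams) (g : ℕ → ℝ) (k : ℕ) [DecidableEq (PBond (F.P p.K) k)]
    (hprov : (towerRepOfRecord F N ν τ texpA ppSel p g k).toRepData.ProvisosEss) :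
    ∫ V, densityOfSlice F N ν τ.M p g k (rstepSlotOfRecord F N ν τ ppSel p g k (texpA p g k)) V ∂(fieldMeasure (F.P p.K) k (SU N))
      = ∫ V, densityOfRepr F N ν τ.M texpA p g k V ∂(fieldMeasure (F.P p.K) k (SU N)) := by
  rw [← rop_towerRepOfRecord_eq_densityOfSlice' F N ν τ texpA ppSel p g k]
  have h := (towerRepOfRecord F N ν τ texpA ppSel p g k).toRepData.integral_rop_eq_of_provisosEss hprov
  rw [TowerRep.toRepData_total, towerRepOfRecord_total] at h
  exact h

/-- **INTEGRABILITY AT A SLOT FAMILY UNDER THE ESSENTIAL FORM**: under `ProvisosEss` of the tower of record at level `k`, the slice density of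
the R-stepped slot is integrable (consumer's instance). [cite: Balaban1989LargeFieldI, (0.3)–(0.4) p.176] -/
theorem integrable_densityOfSlice_rstepSlotOfRecord_of_provisosEss (texpA : TexpAOfRecord F N ν τ.M) (ppSel : PpSelOfRecord F ν τ.M)
    (p : B12.RunParams) (g : ℕ → ℝ) (k : ℕ) [DecidableEq (PBond (F.P p.K) k)]
    (hprov : (towerRepOfRecord F N ν τ texpA ppSel p g k).toRepData.ProvisosEss) :
    Integrable (densityOfSlice F N ν τ.M p g k (rstepSlotOfRecord F N ν τ ppSel p g k (texpA p g k))) (fieldMeasure (F.P p.K) k (SU N)) := by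
  rw [← rop_towerRepOfRecord_eq_densityOfSlice' F N ν τ texpA ppSel p g k]
  exact RepData.integrable_rop_of_provisosEss _ hprov

/-- **(0.4) AT A SLOT FAMILY FROM DISPLAYED A.E. SLOT PROPERTIES** (composite of the two previous faces). [cite: Balaban1989LargeFieldI, (0.4) p.176] -/
theorem integral_densityOfSlice_rstepSlotOfRecord_of_slots_ae (texpA : TexpAOfRecord F N ν τ.M) (ppSel : PpSelOfRecord F ν τ.M)
    (p : B12.RunParams) (g : ℕ → ℝ) (k : ℕ) [DecidableEq (PBond (F.P p.K) k)]
    (hχm : ∀ s, AEStronglyMeasurable (chiSeqOfRecord F N ν τ.M g p.K k s) (fieldMeasure (F.P p.K) k (SU N)))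
    (hTm : ∀ s, AEStronglyMeasurable (texpA p g k s) (fieldMeasure (F.P p.K) k (SU N)))
    (hT0 : ∀ s, ∀ᵐ V ∂(fieldMeasure (F.P p.K) k (SU N)), 0 ≤ texpA p g k s V)
    (hTC : ∃ C : ℝ, ∀ s, ∀ᵐ V ∂(fieldMeasure (F.P p.K) k (SU N)), texpA p g k s V ≤ C)
    (hsupp : ∀ s, ∀ᵐ V ∂(fieldMeasure (F.P p.K) k (SU N)), fibreIntegral (fibOfSeq F ν τ p g k s)
        (fun V => chiSeqOfRecord F N ν τ.M g p.K k (ppSel p g k s) V * texpA p g k (ppSel p g k s) V) V = 0 →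
      chiSeqOfRecord F N ν τ.M g p.K k s V = 0 ∨ texpA p g k s V = 0) :
    ∫ V, densityOfSlice F N ν τ.M p g k (rstepSlotOfRecord F N ν τ ppSel p g k (texpA p g k)) V ∂(fieldMeasure (F.P p.K) k (SU N))
      = ∫ V, densityOfRepr F N ν τ.M texpA p g k V ∂(fieldMeasure (F.P p.K) k (SU N)) :=
  integral_densityOfSlice_rstepSlotOfRecord_of_provisosEss F N ν τ texpA ppSel p g k
    (provisosEss_towerRepOfRecord_of_slots_ae F N ν τ texpA ppSel p g k hχm hTm hT0 hTC hsupp)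

/-- **INTEGRABILITY OF THE R-STEPPED SLICE DENSITY FROM DISPLAYED A.E. SLOT PROPERTIES** (composite). [cite: Balaban1989LargeFieldI, (0.3)–(0.4) p.176] -/
theorem integrable_densityOfSlice_rstepSlotOfRecord_of_slots_ae (texpA : TexpAOfRecord F N ν τ.M) (ppSel : PpSelOfRecord F ν τ.M)
    (p : B12.RunParams) (g : ℕ → ℝ) (k : ℕ) [DecidableEq (PBond (F.P p.K) k)]
    (hχm : ∀ s, AEStronglyMeasurable (chiSeqOfRecord F N ν τ.M g p.K k s) (fieldMeasure (F.P p.K) k (SU N)))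
    (hTm : ∀ s, AEStronglyMeasurable (texpA p g k s) (fieldMeasure (F.P p.K) k (SU N)))
    (hT0 : ∀ s, ∀ᵐ V ∂(fieldMeasure (F.P p.K) k (SU N)), 0 ≤ texpA p g k s V)
    (hTC : ∃ C : ℝ, ∀ s, ∀ᵐ V ∂(fieldMeasure (F.P p.K) k (SU N)), texpA p g k s V ≤ C)
    (hsupp : ∀ s, ∀ᵐ V ∂(fieldMeasure (F.P p.K) k (SU N)), fibreIntegral (fibOfSeq F ν τ p g k s)
        (fun V => chiSeqOfRecord F N ν τ.M g p.K k (ppSel p g k s) V * texpA p g k (ppSel p g k s) V) V = 0 →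
      chiSeqOfRecord F N ν τ.M g p.K k s V = 0 ∨ texpA p g k s V = 0) :
    Integrable (densityOfSlice F N ν τ.M p g k (rstepSlotOfRecord F N ν τ ppSel p g k (texpA p g k))) (fieldMeasure (F.P p.K) k (SU N)) :=
  integrable_densityOfSlice_rstepSlotOfRecord_of_provisosEss F N ν τ texpA ppSel p g k
    (provisosEss_towerRepOfRecord_of_slots_ae F N ν τ texpA ppSel p g k hχm hTm hT0 hTC hsupp)

variable {ν τ}

/-- **v1.3 at a tower carried as `RepData`**: on a density a.e.-equal to the tower's total, under `ProvisosEss` (consumer's instance), `R` of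
record over the essential form IS the explicit (0.3) of the tower. [cite: Balaban1989LargeFieldI, (0.3) p.176] -/
theorem ROp03EssOfRecord_repOfDataAE_of_ae (T : RepDataTower F N) {p : B12.RunParams} {k : ℕ} [DecidableEq (PBond (F.P p.K) (k + 1))]
    {ρ : Density (F.P p.K) (k + 1) (SU N)} (hae : (T p k).total =ᵐ[fieldMeasure (F.P p.K) (k + 1) (SU N)] ρ)
    (hprov : (T p k).ProvisosEss) : ROp03EssOfRecord F N (repOfDataAE F N T) p k ρ = (T p k).rop :=
  (ROp03ByOfRecord_repOfDataAE_of_ae F N (ProvisoFormOfRecord.ess F N) T hae ((provisosEss_instIrrel _ _ _).1 hprov)).trans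
    (rop_instIrrel _ _ _)

variable (ν τ)

/-- **v1.3 at the tower OF RECORD**: on a density a.e.-equal to the record's represented density after `k + 1` steps, under `ProvisosEss` of
the tower datum (consumer's instance), `R` of record over the essential form IS the explicit (0.3) of the tower of record.
[cite: Balaban1989LargeFieldI, (0.3)–(0.4) p.176] -/
theorem ROp03EssOfRecord_repOfRecordAE_of_ae (texpA : TexpAOfRecord F N ν τ.M) (ppSel : PpSelOfRecord F ν τ.M)
    (gsel : B12.RunParams → ℕ → ℝ) (p : B12.RunParams) (k : ℕ) [DecidableEq (PBond (F.P p.K) (k + 1))]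
    {ρ : Density (F.P p.K) (k + 1) (SU N)}
    (hae : (towerOfRecord F N ν τ texpA ppSel gsel p k).toRepData.total =ᵐ[fieldMeasure (F.P p.K) (k + 1) (SU N)] ρ)
    (hprov : (towerOfRecord F N ν τ texpA ppSel gsel p k).toRepData.ProvisosEss) :
    ROp03EssOfRecord F N (repOfRecordAE F N ν τ texpA ppSel gsel) p k ρ
      = (towerOfRecord F N ν τ texpA ppSel gsel p k).toRepData.rop :=
  ROp03EssOfRecord_repOfDataAE_of_ae F N (fun p k => (towerOfRecord F N ν τ texpA ppSel gsel p k).toRepData) hae hprov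

/-- **v1.3 maps the represented density of a slot family to the slice density of its R-stepped slot** (under the a.e. identity and the
ESSENTIAL provisos of the tower datum, consumer's instance). [cite: Balaban1989LargeFieldI, (0.3)–(0.4) p.176; Balaban1988Convergent, Theorem 1 p.262] -/
theorem ROp03EssOfRecord_repOfRecordAE_eq_densityOfSlice (texpA : TexpAOfRecord F N ν τ.M) (ppSel : PpSelOfRecord F ν τ.M)
    (gsel : B12.RunParams → ℕ → ℝ) (p : B12.RunParams) (k : ℕ) [DecidableEq (PBond (F.P p.K) (k + 1))]
    {ρ : Density (F.P p.K) (k + 1) (SU N)}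
    (hae : (towerOfRecord F N ν τ texpA ppSel gsel p k).toRepData.total =ᵐ[fieldMeasure (F.P p.K) (k + 1) (SU N)] ρ)
    (hprov : (towerOfRecord F N ν τ texpA ppSel gsel p k).toRepData.ProvisosEss) :
    ROp03EssOfRecord F N (repOfRecordAE F N ν τ texpA ppSel gsel) p k ρ
      = densityOfSlice F N ν τ.M p (gsel p) (k + 1)
          (rstepSlotOfRecord F N ν τ ppSel p (gsel p) (k + 1) (texpA p (gsel p) (k + 1))) :=
  (ROp03EssOfRecord_repOfRecordAE_of_ae F N ν τ texpA ppSel gsel p k hae hprov).trans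
    (rop_towerRepOfRecord_eq_densityOfSlice' F N ν τ texpA ppSel p (gsel p) (k + 1))

/-- **(0.4) for v1.3 at the tower of record, in slot form**: under the a.e. identity alone, `∫ R ρ dV = ∫ (represented density) dV`
(v1.3's (0.4) for every density composed with the a.e. identity; no proviso needed). [cite: Balaban1989LargeFieldI, (0.4) p.176] -/
theorem integral_ROp03EssOfRecord_repOfRecordAE (texpA : TexpAOfRecord F N ν τ.M) (ppSel : PpSelOfRecord F ν τ.M)
    (gsel : B12.RunParams → ℕ → ℝ) (p : B12.RunParams) (k : ℕ) {ρ : Density (F.P p.K) (k + 1) (SU N)}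
    (hae : (towerOfRecord F N ν τ texpA ppSel gsel p k).toRepData.total =ᵐ[fieldMeasure (F.P p.K) (k + 1) (SU N)] ρ) :
    ∫ V, ROp03EssOfRecord F N (repOfRecordAE F N ν τ texpA ppSel gsel) p k ρ V ∂(fieldMeasure (F.P p.K) (k + 1) (SU N))
      = ∫ V, densityOfRepr F N ν τ.M texpA p (gsel p) (k + 1) V ∂(fieldMeasure (F.P p.K) (k + 1) (SU N)) := by
  rw [preservesIntegral_ROp03EssOfRecord' F N (repOfRecordAE F N ν τ texpA ppSel gsel) p k ρ]
  exact (integral_congr_ae hae).symm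

end Record

end Literature.MathematicalPhysics.QuantumFieldTheory.Balaban1983to89.Node00

end
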